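import Summits.QuantumFields.BalabanUV.Beta.D1BFx.PackedCoframeSiteWords

/-!
# BetaPertH road «BF-x» — «COFRAME-PACK-2» P3a′: the inner SITE words of the packed twisted mixed weight jet as `perT (arr Z)`

STATUS: [folklore] torus bookkeeping of the road's (A1)-PACKED identity (BINDER row D1, slot (K), chain step (I)); NOT an estimate of Bałaban's,
NOT a discharge of any root-level binder.  Provenance: reconstruction; the manuscript(s) under audit are NOT citable.

WHAT.  On the torus `Site 4 ((m+1)·p)`, over any basis `N` of `ker Ŝ` (`Ĉ = perT Cgh`, `KGhostLegJunction`), with the packed letters of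
`PackedCoframeSiteWords` §2 (`Jw = perT (arr gW)`, `Qw = perT (arr qW)`, `J₂ = perT (arr d2W)`, `Q₂ = perT (arr l2W)`), the eight inner site words of
P2's nine packed words are periodised arrays of explicit `ℤ⁴` kernels (legs absorbed by `perT_mul_perT_arr` ∕ `perT_arr_mul_perT`, the wrap-around of a
second packed factor by `perT_arr_mul_perT_arr`): `Lhat_Chat_J`, `J_Chat_Lhat`, `Lhat_Chat_J₂`, `J_Chat_J`, `Lhat_Chat_Q_Chat_Lhat`, `Lhat_Chat_Q_Chat_J`,
`Lhat_Chat_Q₂_Chat_Lhat`, `Lhat_Chat_Q_Chat_Q_Chat_Lhat`.  All [folklore].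
Unit `b2b-balaban-beta-d1-formalise-leaf-03` (gen 23); road owner `b2b-balaban-beta-d1-p2` (W-d1p2-g18-4∕-5, journal l.40583).
-/

noncomputable section

namespace Summit.QuantumFields.BalabanUV.Beta.D1BFx.PackedCoframeSiteProducts

open Matrix
open scoped BigOperators
open Literature.Probability.LatticeModels (TorusSite)
open Literature.MathematicalPhysics.QuantumFieldTheory.Balaban1983to89
open Literature.MathematicalPhysics.QuantumFieldTheory.Balaban1983to89.Beta
open B12Sec2to5 (l1 l1_nonneg)
open ExpKernelCalculus (MKer BiLoc Decays comp shiftK Zl biLoc_comp_decays)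
open OneStepResolventKernel (wsum)
open BalabanStepJetsSucc (biLoc_comp_right)
open Summit.QuantumFields.BalabanUV.Beta.TameKernelCalculus (decays_of_le)
open Summit.QuantumFields.BalabanUV.Beta.D1BFx.SortedReblocking (torusBlockEquiv)
open Summit.QuantumFields.BalabanUV.Beta.D1BFx.SortedEmbedding (e₁)
open Summit.QuantumFields.BalabanUV.Beta.D1BFx.PeriodicArrays (arr toF)
open Summit.QuantumFields.BalabanUV.Beta.D1BFx.TorusCombKKT (I)
open Summit.QuantumFields.BalabanUV.Beta.D1BFx.PeriodisedProjector (Lhat Shat)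
open Summit.QuantumFields.BalabanUV.Beta.D1BFx.TorusCoframeJets (Ljet Ljet₂)
open Summit.QuantumFields.BalabanUV.Beta.D1BFx.TorusWeightJetsCombFree (Lsq₁ Lsq₁₁ Chat)
open Summit.QuantumFields.BalabanUV.Beta.D1BFx.KGhostLeg (Cgh)
open Summit.QuantumFields.BalabanUV.Beta.D1BFx.KGhostLegJunction (Chat_eq_submatrix_periodiseF_Cgh)
open Summit.QuantumFields.BalabanUV.Beta.D1BFx.TorusGhostWordArrays (perT lapU lapU_imageShift perT_mul_perT_arr perT_arr_mul_perT)
open Summit.QuantumFields.BalabanUV.Beta.D1BFx.TorusGhostPairStencils (perT_arr_mul_perT_arr)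
open Summit.QuantumFields.BalabanUV.Beta.D1BFx.TorusBondArrays (dB dB_pos decays_lapU_Cgh decays_Cgh_lapU lapU_Cgh_imageShift Cgh_lapU_imageShift
  Lhat_mul_perT_Cgh perT_Cgh_mul_Lhat)
open Summit.QuantumFields.BalabanUV.Beta.D1BFx.TorusMixedLetters (decays_Cgh_dB)
open Summit.QuantumFields.BalabanUV.Beta.D1BFx.TorusTwoArrayWords (biLoc_comp_arr)
open Summit.QuantumFields.BalabanUV.Beta.D1BFx.PackedCoframeSiteWords (perW gW qW d2W l2W biLoc_gW biLoc_qW biLoc_d2W_perW biLoc_l2W rate_aux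
  biLoc_gW_Cgh biLoc_LC_qW biLoc_LC_qW_Cgh sum_smul_Ljet_eq sum_smul_Lsq₁_eq sum_smul_Ljet₂_eq sum_sum_smul_Lsq₁₁_eq)

variable (m : ℕ) {a : ℝ} (p : ℕ) [NeZero p] {ρ : Type*} [Fintype ρ] [DecidableEq ρ] {N : Matrix (Site 4 ((m + 1) * p)) ρ ℝ}
  {w w' : Fin 4 → (Fin 4 → ℤ) → ℝ} {C C' δ : ℝ} {P P' : Fin 4 → ℤ} {r r' : I 3 (m + 1) p → ℝ}

/-- [folklore] **`L̂·Ĉ·Jw = perT (arr ((lapU∘Cgh) ∘ gW w))`**. -/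
theorem Lhat_Chat_J (ha : 0 < a) (hN : ∀ lam : Site 4 ((m + 1) * p) → ℝ, Shat m ((m + 1) * p) *ᵥ lam = 0 ↔ ∃ c : ρ → ℝ, lam = N *ᵥ c)
    (hNinj : Function.Injective N.mulVec) (hw : ∀ κ u, |w κ u| ≤ C * Real.exp (-δ * l1 (u - P))) (hδ : 0 < δ)
    (hr : ∀ k, r k = ∑' t : Fin 4 → ℤ, w k.2.2 (imageShift ((m + 1) * p) (windowMap 4 ((m + 1) * p) (torusBlockEquiv (m + 1) p (k.1, k.2.1))) t)) :
    Lhat ((m + 1) * p) * Chat ((m + 1) * p) N * (∑ k : I 3 (m + 1) p, r k • Ljet ((m + 1) * p) (e₁ (m + 1) p k))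
      = perT ((m + 1) * p) (arr ((m + 1) * p) (comp (comp lapU (Cgh (m + 1) a)) (gW w))) := by
  obtain ⟨CA, hA⟩ := decays_lapU_Cgh (m + 1) a ha
  have hCh : Chat ((m + 1) * p) N = perT ((m + 1) * p) (Cgh (m + 1) a) := Chat_eq_submatrix_periodiseF_Cgh m p ha hN hNinj
  rw [sum_smul_Ljet_eq p hw hδ hr, hCh, Lhat_mul_perT_Cgh a m p ha,
    perT_mul_perT_arr _ hA (half_pos (dB_pos (m + 1) a ha)) (lapU_Cgh_imageShift (m + 1) a ha p) (biLoc_gW hw hδ) (half_pos hδ)]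

/-- [folklore] **`Jw·Ĉ·L̂ = perT (arr (gW w ∘ (Cgh∘lapU)))`**. -/
theorem J_Chat_Lhat (ha : 0 < a) (hN : ∀ lam : Site 4 ((m + 1) * p) → ℝ, Shat m ((m + 1) * p) *ᵥ lam = 0 ↔ ∃ c : ρ → ℝ, lam = N *ᵥ c)
    (hNinj : Function.Injective N.mulVec) (hw : ∀ κ u, |w κ u| ≤ C * Real.exp (-δ * l1 (u - P))) (hδ : 0 < δ)
    (hr : ∀ k, r k = ∑' t : Fin 4 → ℤ, w k.2.2 (imageShift ((m + 1) * p) (windowMap 4 ((m + 1) * p) (torusBlockEquiv (m + 1) p (k.1, k.2.1))) t)) :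
    (∑ k : I 3 (m + 1) p, r k • Ljet ((m + 1) * p) (e₁ (m + 1) p k)) * Chat ((m + 1) * p) N * Lhat ((m + 1) * p)
      = perT ((m + 1) * p) (arr ((m + 1) * p) (comp (gW w) (comp (Cgh (m + 1) a) lapU))) := by
  obtain ⟨CA, hA⟩ := decays_Cgh_lapU (m + 1) a ha
  have hCh : Chat ((m + 1) * p) N = perT ((m + 1) * p) (Cgh (m + 1) a) := Chat_eq_submatrix_periodiseF_Cgh m p ha hN hNinj
  rw [sum_smul_Ljet_eq p hw hδ hr, hCh, Matrix.mul_assoc, perT_Cgh_mul_Lhat a m p ha,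
    perT_arr_mul_perT _ hA (half_pos (dB_pos (m + 1) a ha)) (Cgh_lapU_imageShift (m + 1) a ha p) (biLoc_gW hw hδ) (half_pos hδ)]

/-- [folklore] **`L̂·Ĉ·J₂ = perT (arr ((lapU∘Cgh) ∘ d2W w (perW s w′)))`**. -/
theorem Lhat_Chat_J₂ (ha : 0 < a) (hN : ∀ lam : Site 4 ((m + 1) * p) → ℝ, Shat m ((m + 1) * p) *ᵥ lam = 0 ↔ ∃ c : ρ → ℝ, lam = N *ᵥ c)
    (hNinj : Function.Injective N.mulVec) (hw : ∀ κ u, |w κ u| ≤ C * Real.exp (-δ * l1 (u - P)))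
    (hw' : ∀ κ u, |w' κ u| ≤ C' * Real.exp (-δ * l1 (u - P'))) (hδ : 0 < δ)
    (hr : ∀ k, r k = ∑' t : Fin 4 → ℤ, w k.2.2 (imageShift ((m + 1) * p) (windowMap 4 ((m + 1) * p) (torusBlockEquiv (m + 1) p (k.1, k.2.1))) t))
    (hr' : ∀ k, r' k = ∑' t : Fin 4 → ℤ, w' k.2.2 (imageShift ((m + 1) * p) (windowMap 4 ((m + 1) * p) (torusBlockEquiv (m + 1) p (k.1, k.2.1))) t)) :
    Lhat ((m + 1) * p) * Chat ((m + 1) * p) N * (∑ k : I 3 (m + 1) p, (r k * r' k) • Ljet₂ ((m + 1) * p) (e₁ (m + 1) p k))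
      = perT ((m + 1) * p) (arr ((m + 1) * p) (comp (comp lapU (Cgh (m + 1) a)) (d2W w (perW ((m + 1) * p) w')))) := by
  obtain ⟨CA, hA⟩ := decays_lapU_Cgh (m + 1) a ha
  have hCh : Chat ((m + 1) * p) N = perT ((m + 1) * p) (Cgh (m + 1) a) := Chat_eq_submatrix_periodiseF_Cgh m p ha hN hNinj
  rw [sum_smul_Ljet₂_eq p hw hw' hδ hr hr', hCh, Lhat_mul_perT_Cgh a m p ha,
    perT_mul_perT_arr _ hA (half_pos (dB_pos (m + 1) a ha)) (lapU_Cgh_imageShift (m + 1) a ha p) (biLoc_d2W_perW hw hw' hδ _) (half_pos hδ)]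

/-- [folklore] **`Jw·Ĉ·Jw′ = perT (arr ((gW w ∘ Cgh) ∘ arr s (gW w′)))`** (the wrap-around sits in TA2's `arr` of the right factor). -/
theorem J_Chat_J (ha : 0 < a) (hN : ∀ lam : Site 4 ((m + 1) * p) → ℝ, Shat m ((m + 1) * p) *ᵥ lam = 0 ↔ ∃ c : ρ → ℝ, lam = N *ᵥ c)
    (hNinj : Function.Injective N.mulVec) (hw : ∀ κ u, |w κ u| ≤ C * Real.exp (-δ * l1 (u - P)))
    (hw' : ∀ κ u, |w' κ u| ≤ C' * Real.exp (-δ * l1 (u - P'))) (hδ : 0 < δ) (hδB : δ ≤ dB (m + 1) a / 8)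
    (hr : ∀ k, r k = ∑' t : Fin 4 → ℤ, w k.2.2 (imageShift ((m + 1) * p) (windowMap 4 ((m + 1) * p) (torusBlockEquiv (m + 1) p (k.1, k.2.1))) t))
    (hr' : ∀ k, r' k = ∑' t : Fin 4 → ℤ, w' k.2.2 (imageShift ((m + 1) * p) (windowMap 4 ((m + 1) * p) (torusBlockEquiv (m + 1) p (k.1, k.2.1))) t)) :
    (∑ k : I 3 (m + 1) p, r k • Ljet ((m + 1) * p) (e₁ (m + 1) p k)) * Chat ((m + 1) * p) N
        * (∑ k : I 3 (m + 1) p, r' k • Ljet ((m + 1) * p) (e₁ (m + 1) p k))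
      = perT ((m + 1) * p) (arr ((m + 1) * p) (comp (comp (gW w) (Cgh (m + 1) a)) (arr ((m + 1) * p) (gW w')))) := by
  obtain ⟨CA, hA⟩ := decays_Cgh_dB m ha
  obtain ⟨K, -, hK⟩ := biLoc_gW_Cgh m ha hw hδ hδB
  have hCh : Chat ((m + 1) * p) N = perT ((m + 1) * p) (Cgh (m + 1) a) := Chat_eq_submatrix_periodiseF_Cgh m p ha hN hNinj
  rw [sum_smul_Ljet_eq p hw hδ hr, sum_smul_Ljet_eq p hw' hδ hr', hCh,
    perT_arr_mul_perT _ hA (half_pos (dB_pos (m + 1) a ha)) (fun x y t u v => KGhostLeg.Cgh_imageShift (m + 1) a ha ⟨p, rfl⟩ x y t u v)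
      (biLoc_gW hw hδ) (half_pos hδ),
    perT_arr_mul_perT_arr _ hK (by linarith) (biLoc_gW hw' hδ) (half_pos hδ)]

/-- [folklore] **`L̂·Ĉ·Qw·Ĉ·L̂ = perT (arr (((lapU∘Cgh) ∘ qW w) ∘ (Cgh∘lapU)))`**. -/
theorem Lhat_Chat_Q_Chat_Lhat (ha : 0 < a)
    (hN : ∀ lam : Site 4 ((m + 1) * p) → ℝ, Shat m ((m + 1) * p) *ᵥ lam = 0 ↔ ∃ c : ρ → ℝ, lam = N *ᵥ c) (hNinj : Function.Injective N.mulVec)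
    (hw : ∀ κ u, |w κ u| ≤ C * Real.exp (-δ * l1 (u - P))) (hδ : 0 < δ) (hδB : δ ≤ dB (m + 1) a / 8)
    (hr : ∀ k, r k = ∑' t : Fin 4 → ℤ, w k.2.2 (imageShift ((m + 1) * p) (windowMap 4 ((m + 1) * p) (torusBlockEquiv (m + 1) p (k.1, k.2.1))) t)) :
    Lhat ((m + 1) * p) * Chat ((m + 1) * p) N * (∑ k : I 3 (m + 1) p, r k • Lsq₁ ((m + 1) * p) (e₁ (m + 1) p k)) * Chat ((m + 1) * p) N
        * Lhat ((m + 1) * p)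
      = perT ((m + 1) * p) (arr ((m + 1) * p) (comp (comp (comp lapU (Cgh (m + 1) a)) (qW w)) (comp (Cgh (m + 1) a) lapU))) := by
  obtain ⟨h1, -, -, hd⟩ := rate_aux m ha hδ hδB
  obtain ⟨CA, hA⟩ := decays_lapU_Cgh (m + 1) a ha
  obtain ⟨CB, hB⟩ := decays_Cgh_lapU (m + 1) a ha
  obtain ⟨K, -, hK⟩ := biLoc_LC_qW m ha hw hδ hδB
  have hCh : Chat ((m + 1) * p) N = perT ((m + 1) * p) (Cgh (m + 1) a) := Chat_eq_submatrix_periodiseF_Cgh m p ha hN hNinj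
  rw [sum_smul_Lsq₁_eq p hw hδ h1 hr, hCh, Matrix.mul_assoc _ (perT ((m + 1) * p) (Cgh (m + 1) a)) (Lhat ((m + 1) * p)),
    Lhat_mul_perT_Cgh a m p ha, perT_Cgh_mul_Lhat a m p ha,
    perT_mul_perT_arr _ hA (half_pos hd) (lapU_Cgh_imageShift (m + 1) a ha p) (biLoc_qW hw hδ h1) (by linarith),
    perT_arr_mul_perT _ hB (half_pos hd) (Cgh_lapU_imageShift (m + 1) a ha p) hK (by linarith)]

/-- [folklore] **`L̂·Ĉ·Qw·Ĉ·Jw′ = perT (arr ((((lapU∘Cgh) ∘ qW w) ∘ Cgh) ∘ arr s (gW w′)))`**. -/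
theorem Lhat_Chat_Q_Chat_J (ha : 0 < a)
    (hN : ∀ lam : Site 4 ((m + 1) * p) → ℝ, Shat m ((m + 1) * p) *ᵥ lam = 0 ↔ ∃ c : ρ → ℝ, lam = N *ᵥ c) (hNinj : Function.Injective N.mulVec)
    (hw : ∀ κ u, |w κ u| ≤ C * Real.exp (-δ * l1 (u - P))) (hw' : ∀ κ u, |w' κ u| ≤ C' * Real.exp (-δ * l1 (u - P'))) (hδ : 0 < δ)
    (hδB : δ ≤ dB (m + 1) a / 8)
    (hr : ∀ k, r k = ∑' t : Fin 4 → ℤ, w k.2.2 (imageShift ((m + 1) * p) (windowMap 4 ((m + 1) * p) (torusBlockEquiv (m + 1) p (k.1, k.2.1))) t))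
    (hr' : ∀ k, r' k = ∑' t : Fin 4 → ℤ, w' k.2.2 (imageShift ((m + 1) * p) (windowMap 4 ((m + 1) * p) (torusBlockEquiv (m + 1) p (k.1, k.2.1))) t)) :
    Lhat ((m + 1) * p) * Chat ((m + 1) * p) N * (∑ k : I 3 (m + 1) p, r k • Lsq₁ ((m + 1) * p) (e₁ (m + 1) p k)) * Chat ((m + 1) * p) N
        * (∑ k : I 3 (m + 1) p, r' k • Ljet ((m + 1) * p) (e₁ (m + 1) p k))
      = perT ((m + 1) * p) (arr ((m + 1) * p)
          (comp (comp (comp (comp lapU (Cgh (m + 1) a)) (qW w)) (Cgh (m + 1) a)) (arr ((m + 1) * p) (gW w')))) := by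
  obtain ⟨h1, -, -, hd⟩ := rate_aux m ha hδ hδB
  obtain ⟨CA, hA⟩ := decays_lapU_Cgh (m + 1) a ha
  obtain ⟨CC, hC⟩ := decays_Cgh_dB m ha
  obtain ⟨K, -, hK⟩ := biLoc_LC_qW m ha hw hδ hδB
  obtain ⟨K', -, hK'⟩ := biLoc_LC_qW_Cgh m ha hw hδ hδB
  have hCh : Chat ((m + 1) * p) N = perT ((m + 1) * p) (Cgh (m + 1) a) := Chat_eq_submatrix_periodiseF_Cgh m p ha hN hNinj
  rw [sum_smul_Lsq₁_eq p hw hδ h1 hr, sum_smul_Ljet_eq p hw' hδ hr', hCh, Lhat_mul_perT_Cgh a m p ha,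
    perT_mul_perT_arr _ hA (half_pos hd) (lapU_Cgh_imageShift (m + 1) a ha p) (biLoc_qW hw hδ h1) (by linarith),
    perT_arr_mul_perT _ hC (half_pos hd) (fun x y t u v => KGhostLeg.Cgh_imageShift (m + 1) a ha ⟨p, rfl⟩ x y t u v) hK (by linarith),
    perT_arr_mul_perT_arr _ hK' (by linarith) (biLoc_gW hw' hδ) (half_pos hδ)]

/-- [folklore] **`L̂·Ĉ·Q₂·Ĉ·L̂ = perT (arr (((lapU∘Cgh) ∘ l2W s w w′) ∘ (Cgh∘lapU)))`**. -/
theorem Lhat_Chat_Q₂_Chat_Lhat (ha : 0 < a)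
    (hN : ∀ lam : Site 4 ((m + 1) * p) → ℝ, Shat m ((m + 1) * p) *ᵥ lam = 0 ↔ ∃ c : ρ → ℝ, lam = N *ᵥ c) (hNinj : Function.Injective N.mulVec)
    (hw : ∀ κ u, |w κ u| ≤ C * Real.exp (-δ * l1 (u - P))) (hw' : ∀ κ u, |w' κ u| ≤ C' * Real.exp (-δ * l1 (u - P'))) (hδ : 0 < δ)
    (hδB : δ ≤ dB (m + 1) a / 8)
    (hr : ∀ k, r k = ∑' t : Fin 4 → ℤ, w k.2.2 (imageShift ((m + 1) * p) (windowMap 4 ((m + 1) * p) (torusBlockEquiv (m + 1) p (k.1, k.2.1))) t))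
    (hr' : ∀ k, r' k = ∑' t : Fin 4 → ℤ, w' k.2.2 (imageShift ((m + 1) * p) (windowMap 4 ((m + 1) * p) (torusBlockEquiv (m + 1) p (k.1, k.2.1))) t)) :
    Lhat ((m + 1) * p) * Chat ((m + 1) * p) N
        * (∑ k : I 3 (m + 1) p, ∑ l : I 3 (m + 1) p, (r k * r' l) • Lsq₁₁ ((m + 1) * p) (e₁ (m + 1) p k) (e₁ (m + 1) p l))
        * Chat ((m + 1) * p) N * Lhat ((m + 1) * p)
      = perT ((m + 1) * p) (arr ((m + 1) * p)
          (comp (comp (comp lapU (Cgh (m + 1) a)) (l2W ((m + 1) * p) w w')) (comp (Cgh (m + 1) a) lapU))) := by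
  obtain ⟨h1, h2, -, hd⟩ := rate_aux m ha hδ hδB
  obtain ⟨CA, hA⟩ := decays_lapU_Cgh (m + 1) a ha
  obtain ⟨CB, hB⟩ := decays_Cgh_lapU (m + 1) a ha
  obtain ⟨K, -, hK⟩ := biLoc_l2W hw hw' hδ h1
  have hCh : Chat ((m + 1) * p) N = perT ((m + 1) * p) (Cgh (m + 1) a) := Chat_eq_submatrix_periodiseF_Cgh m p ha hN hNinj
  have hLC : BiLoc (comp (comp lapU (Cgh (m + 1) a)) (l2W ((m + 1) * p) w w')) P P _ (δ / 16) :=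
    biLoc_comp_decays (decays_of_le hA (by linarith : δ / 8 ≤ dB (m + 1) a / 2)) (hK _) (by linarith : 0 ≤ δ / 16) (by linarith)
  rw [sum_sum_smul_Lsq₁₁_eq p hw hw' hδ h2 hr hr', hCh, Matrix.mul_assoc _ (perT ((m + 1) * p) (Cgh (m + 1) a)) (Lhat ((m + 1) * p)),
    Lhat_mul_perT_Cgh a m p ha, perT_Cgh_mul_Lhat a m p ha,
    perT_mul_perT_arr _ hA (half_pos hd) (lapU_Cgh_imageShift (m + 1) a ha p) (hK _) (by linarith),
    perT_arr_mul_perT _ hB (half_pos hd) (Cgh_lapU_imageShift (m + 1) a ha p) hLC (by linarith)]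

/-- [folklore] **`L̂·Ĉ·Qw·Ĉ·Qw′·Ĉ·L̂ = perT (arr (((((lapU∘Cgh) ∘ qW w) ∘ Cgh) ∘ arr s (qW w′)) ∘ (Cgh∘lapU)))`**. -/
theorem Lhat_Chat_Q_Chat_Q_Chat_Lhat (ha : 0 < a)
    (hN : ∀ lam : Site 4 ((m + 1) * p) → ℝ, Shat m ((m + 1) * p) *ᵥ lam = 0 ↔ ∃ c : ρ → ℝ, lam = N *ᵥ c) (hNinj : Function.Injective N.mulVec)
    (hw : ∀ κ u, |w κ u| ≤ C * Real.exp (-δ * l1 (u - P))) (hw' : ∀ κ u, |w' κ u| ≤ C' * Real.exp (-δ * l1 (u - P'))) (hδ : 0 < δ)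
    (hδB : δ ≤ dB (m + 1) a / 8)
    (hr : ∀ k, r k = ∑' t : Fin 4 → ℤ, w k.2.2 (imageShift ((m + 1) * p) (windowMap 4 ((m + 1) * p) (torusBlockEquiv (m + 1) p (k.1, k.2.1))) t))
    (hr' : ∀ k, r' k = ∑' t : Fin 4 → ℤ, w' k.2.2 (imageShift ((m + 1) * p) (windowMap 4 ((m + 1) * p) (torusBlockEquiv (m + 1) p (k.1, k.2.1))) t)) :
    Lhat ((m + 1) * p) * Chat ((m + 1) * p) N * (∑ k : I 3 (m + 1) p, r k • Lsq₁ ((m + 1) * p) (e₁ (m + 1) p k)) * Chat ((m + 1) * p) N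
        * (∑ k : I 3 (m + 1) p, r' k • Lsq₁ ((m + 1) * p) (e₁ (m + 1) p k)) * Chat ((m + 1) * p) N * Lhat ((m + 1) * p)
      = perT ((m + 1) * p) (arr ((m + 1) * p)
          (comp (comp (comp (comp (comp lapU (Cgh (m + 1) a)) (qW w)) (Cgh (m + 1) a)) (arr ((m + 1) * p) (qW w'))) (comp (Cgh (m + 1) a) lapU))) := by
  obtain ⟨h1, -, -, hd⟩ := rate_aux m ha hδ hδB
  obtain ⟨CA, hA⟩ := decays_lapU_Cgh (m + 1) a ha
  obtain ⟨CB, hB⟩ := decays_Cgh_lapU (m + 1) a ha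
  obtain ⟨CC, hC⟩ := decays_Cgh_dB m ha
  obtain ⟨K, -, hK⟩ := biLoc_LC_qW m ha hw hδ hδB
  obtain ⟨K', -, hK'⟩ := biLoc_LC_qW_Cgh m ha hw hδ hδB
  have hq' := StepJetData.biLoc_weaken (biLoc_qW hw' hδ h1) le_rfl (by linarith : δ / 16 ≤ δ / 4)
  have hX : BiLoc (comp (comp (comp (comp lapU (Cgh (m + 1) a)) (qW w)) (Cgh (m + 1) a)) (arr ((m + 1) * p) (qW w'))) P P _ (δ / 16 / 4) :=
    biLoc_comp_arr _ hK' hq' (by linarith)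
  have hCh : Chat ((m + 1) * p) N = perT ((m + 1) * p) (Cgh (m + 1) a) := Chat_eq_submatrix_periodiseF_Cgh m p ha hN hNinj
  rw [sum_smul_Lsq₁_eq p hw hδ h1 hr, sum_smul_Lsq₁_eq p hw' hδ h1 hr', hCh,
    Matrix.mul_assoc _ (perT ((m + 1) * p) (Cgh (m + 1) a)) (Lhat ((m + 1) * p)), Lhat_mul_perT_Cgh a m p ha, perT_Cgh_mul_Lhat a m p ha,
    perT_mul_perT_arr _ hA (half_pos hd) (lapU_Cgh_imageShift (m + 1) a ha p) (biLoc_qW hw hδ h1) (by linarith),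
    perT_arr_mul_perT _ hC (half_pos hd) (fun x y t u v => KGhostLeg.Cgh_imageShift (m + 1) a ha ⟨p, rfl⟩ x y t u v) hK (by linarith),
    perT_arr_mul_perT_arr _ hK' (by linarith) (biLoc_qW hw' hδ h1) (by linarith),
    perT_arr_mul_perT _ hB (half_pos hd) (Cgh_lapU_imageShift (m + 1) a ha p) hX (by linarith)]

end Summit.QuantumFields.BalabanUV.Beta.D1BFx.PackedCoframeSiteProducts

end
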